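import Mathlib.Data.ZMod.Basic
import Mathlib.Tactic.NormNum
import HarnessLib

/-!
# Venture HSemireg — THEOREM 35-B's residue count «the `A mod d` with `A² ≡ −2` number `2^{ω(d′)}`» at the determinants of record, and
# the one-orbit determinants `ℓ^e, 2ℓ^e` (ENGINE-W PROBE5 §35 (3)) — kernel arithmetic

HONEST FRAMING. Lean index of the computation cell `pub-hsemireg`, widening group ENGINE-W (code A, seat `engine-w-1`,
gen 17). FINITE MODULAR ARITHMETIC (`ℤ∕d` for the listed `d`); no abelian variety, sheaf, `Ext` group, secant structure or
semiregularity map is constructed; nothing here says that HC, HC_CM or HC_AV holds. Theorems only (0 `def`, 0 named fact, 0 `sorry`).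
New namespace `TargetResidues`; companion of `NoProductOfLocalSigns.lean` (`d = 561`).

SOURCE (the cell's own result): `widen/ENGINE-W/out/probe5/PROBE5-STIZ-A.md` §35 (3) (v4.1, engine-w-1 g10), **THEOREM 35-B** as printed:
«The residues `A mod d` with `A² ≡ −2` number `2^{ω(d′)}` (`d′` = odd part of `d`; `2 ∥ d` at most, `4 ∤ A² + 2`), permuted in σ-orbits
`{A, −A}`; so **if `det H = ℓ^e` or `2ℓ^e` (`ℓ` an odd prime, `3` included) the class of `Λ_X(H; A, N)` — reached or never — is the SAME
AT EVERY integral oriented target** … Target dependence needs `ω(d′) ≥ 2`», and the determinants that occur in §31–§38 and SEC44 (`3, 9,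
27; 6, 18, 54; 11, 17, 19, 22, 34, 38; 33, 51, 57, 66, 99, 102, 114, 129, 187, 209; 561, 627, 1122`). What the kernel holds:

* §1 `four_not_dvd_sq_add_two` — `4 ∤ A² + 2` (so `2 ∥ d` at most), in `ℤ∕4` (the `ℤ`-form is the landed `PairBlock.sq_add_two_not_dvd_four`, not restated).
* §2 **`one_orbit_determinants`** — exactly TWO roots of `A² = −2` (one σ-orbit `{A, −A}`) in `ℤ∕d` for `d = 3, 9, 27, 6, 18, 54, 11,
  17, 19, 22, 34, 38` (`d = ℓ^e` or `2ℓ^e`), and ONE root for `d = 2`.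
* §3 **`two_orbit_determinants`** — exactly FOUR roots (`2^{ω(d′)}`, `ω(d′) = 2`) for `d = 33, 51, 57, 66, 99, 102, 114, 129, 187, 209`,
  with the SEC44 ∕ §38 roots of record: `d = 99`: `A ∈ {14, 41, 58, 85}` («roots `A = 41` and `A = 14`»), `d = 33`: `{8, 14, 19, 25}`.
* §4 **`three_orbit_determinants`** — exactly EIGHT roots for `d = 627 = 3·11·19` and `d = 1122 = 2·3·11·17` (`561` is
  `LocalSigns.card_roots_561`).
WHAT IS NOT HERE: the CRT proof of `2^{ω(d′)}` for general `d`; classes, targets, THEOREM 35-B's isometries.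
-/

namespace Summit.Ventures.HSemireg.TargetResidues

/-! ## §1 `4 ∤ A² + 2` -/

/-- **«`4 ∤ A² + 2`»** (so an admissible determinant has `2 ∥ d` at most): in `ℤ∕4`, `A² + 2 ≠ 0`. [kernel, `decide`] -/
theorem four_not_dvd_sq_add_two : ∀ A : ZMod 4, A ^ 2 + 2 ≠ 0 := by
  decide

/-! ## §2 One σ-orbit: `d = ℓ^e` or `2ℓ^e` -/

/-- **One-orbit determinants**: `#{A ∈ ℤ∕d : A² = −2} = 2` for `d = 3, 9, 27, 6, 18, 54, 11, 17, 19, 22, 34, 38` and `= 1` for `d = 2`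
(«if `det H = ℓ^e` or `2ℓ^e` … the class … is the SAME AT EVERY integral oriented target»). [kernel, `decide`] -/
theorem one_orbit_determinants :
    (Finset.univ.filter fun A : ZMod 2 => A ^ 2 = -2).card = 1 ∧
    (Finset.univ.filter fun A : ZMod 3 => A ^ 2 = -2).card = 2 ∧
    (Finset.univ.filter fun A : ZMod 9 => A ^ 2 = -2).card = 2 ∧
    (Finset.univ.filter fun A : ZMod 27 => A ^ 2 = -2).card = 2 ∧
    (Finset.univ.filter fun A : ZMod 6 => A ^ 2 = -2).card = 2 ∧
    (Finset.univ.filter fun A : ZMod 18 => A ^ 2 = -2).card = 2 ∧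
    (Finset.univ.filter fun A : ZMod 54 => A ^ 2 = -2).card = 2 ∧
    (Finset.univ.filter fun A : ZMod 11 => A ^ 2 = -2).card = 2 ∧
    (Finset.univ.filter fun A : ZMod 17 => A ^ 2 = -2).card = 2 ∧
    (Finset.univ.filter fun A : ZMod 19 => A ^ 2 = -2).card = 2 ∧
    (Finset.univ.filter fun A : ZMod 22 => A ^ 2 = -2).card = 2 ∧
    (Finset.univ.filter fun A : ZMod 34 => A ^ 2 = -2).card = 2 ∧
    (Finset.univ.filter fun A : ZMod 38 => A ^ 2 = -2).card = 2 := by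
  refine ⟨?_, ?_, ?_, ?_, ?_, ?_, ?_, ?_, ?_, ?_, ?_, ?_, ?_⟩ <;> decide +kernel

/-! ## §3 Two σ-orbits: `ω(d′) = 2` -/

/-- **Two-orbit determinants**: `#{A : A² = −2} = 4` in `ℤ∕d` for `d = 33, 51, 57, 66, 99, 102, 114, 129, 187, 209`. [kernel, `decide`] -/
theorem two_orbit_determinants :
    (Finset.univ.filter fun A : ZMod 33 => A ^ 2 = -2).card = 4 ∧
    (Finset.univ.filter fun A : ZMod 51 => A ^ 2 = -2).card = 4 ∧
    (Finset.univ.filter fun A : ZMod 57 => A ^ 2 = -2).card = 4 ∧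
    (Finset.univ.filter fun A : ZMod 66 => A ^ 2 = -2).card = 4 ∧
    (Finset.univ.filter fun A : ZMod 99 => A ^ 2 = -2).card = 4 ∧
    (Finset.univ.filter fun A : ZMod 102 => A ^ 2 = -2).card = 4 ∧
    (Finset.univ.filter fun A : ZMod 114 => A ^ 2 = -2).card = 4 ∧
    (Finset.univ.filter fun A : ZMod 129 => A ^ 2 = -2).card = 4 ∧
    (Finset.univ.filter fun A : ZMod 187 => A ^ 2 = -2).card = 4 ∧
    (Finset.univ.filter fun A : ZMod 209 => A ^ 2 = -2).card = 4 := by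
  refine ⟨?_, ?_, ?_, ?_, ?_, ?_, ?_, ?_, ?_, ?_⟩ <;> decide +kernel

/-- The roots of record: `d = 99`: `{14, 41, 58, 85}` (SEC44 ∕ TABLE-ENGINE-W «`d = 99` … roots `A = 41` and `A = 14`»; `85 = −14`,
`58 = −41`), `d = 33`: `{8, 14, 19, 25}`, `d = 187`: `{41, 58, 129, 146}`, `d = 209`: `{25, 63, 146, 184}`. [kernel, `decide`] -/
theorem roots_of_record :
    (Finset.univ.filter fun A : ZMod 99 => A ^ 2 = -2) = {14, 41, 58, 85} ∧
    (Finset.univ.filter fun A : ZMod 33 => A ^ 2 = -2) = {8, 14, 19, 25} ∧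
    (Finset.univ.filter fun A : ZMod 187 => A ^ 2 = -2) = {41, 58, 129, 146} ∧
    (Finset.univ.filter fun A : ZMod 209 => A ^ 2 = -2) = {25, 63, 146, 184} := by
  refine ⟨?_, ?_, ?_, ?_⟩ <;> decide +kernel

/-! ## §4 Three σ-orbits: `ω(d′) = 3` -/

/-- **Three-orbit determinants**: `#{A : A² = −2} = 8 = 2³` in `ℤ∕627` (`627 = 3·11·19`) and in `ℤ∕1122` (`1122 = 2·3·11·17`); with
`LocalSigns.card_roots_561` (`561 = 3·11·17`) these are 35-C's three census determinants. [kernel, `decide`] -/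
theorem three_orbit_determinants :
    (Finset.univ.filter fun A : ZMod 627 => A ^ 2 = -2).card = 8 ∧
    (Finset.univ.filter fun A : ZMod 1122 => A ^ 2 = -2).card = 8 ∧
    (627 : ℕ) = 3 * 11 * 19 ∧ (1122 : ℕ) = 2 * 3 * 11 * 17 := by
  refine ⟨?_, ?_, by norm_num, by norm_num⟩ <;> decide +kernel

end Summit.Ventures.HSemireg.TargetResidues
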